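import Literature.MathematicalPhysics.QuantumFieldTheory.Balaban1983to89.B9SectCLatticeOrder

/-!
# `Balaban1983to89.B9SectCLatticeCarrier` — THE D1 CARRIERS of the abstract lattice calculus: the unit periodic
# lattice `Π_i ℤ/P_iℤ` with its bonds and plaquettes, the covariant derivative (3.3), its adjoint (3.8) and the
# curl (3.4)/(3.5) as CARRIED `(1, c)`-TABLES over an arbitrary scalar bond field, the GLOBAL direction devices
# with their cutoff facts, and the bond facts against an ARBITRARY frame (census §5 D1, first carrier leaf) — OURS
# (typing of the printed operators; scalar reading)

CITATION HEADER (LEAF RULE: no quotation in this file; pointers BY NAME only).  The printed operators typed here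
are those of Balaban, *Commun. Math. Phys.* **99** (1985) 389–434, beginning of §C: the covariant derivative of a
scalar lattice field along a bond with the parallel transporter of the background configuration ((3.3)), the
covariant exterior derivative of a 1-form on plaquettes as the antisymmetrised covariant difference ((3.4), (3.5)),
the adjoint `D*` on 1-forms ((3.8)) and the support of the adjoint on 2-forms ((3.9)); the verbatim setting is
quoted in the headers of `…B9SectCDiff` and `…B9SectCDiffCutModel`.  What this file takes from print is exactly the
SHAPE of those four formulas — which bond reads which site / which plaquette reads which bond, with which sign and
weight — with the transporter `R(U(b))` replaced by a SCALAR bond field (caveat (1)); the theorems typing them carry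
`[cite: …]` tags with the equation numbers, the lattice API carries `[folklore]`.  Tree inputs, by name:
`B4Sect5Torus.{TSite, ccoord, tdist, tdist_symm, circAbs_zero}` and `B4TorusKernel.MultiPeriod.{circAbs,
circAbs_add_mul, circAbs_le_abs}` (the multi-period torus and its sup-distance); `B9SectCDiffEstimate.{Frame,
Frame.Valid, OpZon}` (`Valid.hsc` only); `B9SectCLatticeCalc.{IsCarried, ThE}`; `B9SectCLatticeOrder.{IsTab,
IsTab.of_support, IsTab.transpose_of_cols, Bonds, opZon_ThE}`; Mathlib's `Function.update`, `Matrix.of`,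
`Matrix.diagonal`, `Matrix.diagonal_mul`, `Matrix.mul_apply`, `Matrix.sum_apply`, `Matrix.mulVec`, `dotProduct`,
`Fintype.sum_prod_type`, `Fintype.sum_eq_add`, `Finset.sum_ite_eq`, `Finset.sum_ite_eq'`, `Finset.card_le_one`,
`Finset.card_image_le`, `Int.mul_ediv_add_emod`, `Int.toNat_le`.  The only import is `…B9SectCLatticeOrder`.
VERSION v1.0.1 (DOCFIX after the cross-read of v1): the docstrings of `pD_mulVec` and `curl_mulVec` (and the §4
bullet below) now point the covariant difference of a component to (3.3) / the display following (3.4) — printed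
(3.5) is the ORIENTATION CONVENTION for reversed bonds, not a difference formula; every declaration is byte-identical
to v1.

WHAT THIS MODULE DOES (census `SectC-inst-census.md` §5 D1 and note N25; claim SECTC-LATTICE-CARRIER).  The three
preceding leaves (`…B9SectCLatticeCalc`, `…Curl`, `…Order`) are stated over ABSTRACT carriers: index types of
sites / bonds / plaquettes with position maps, `h`-free entry tables `T, J, T′, J′` known only through their
supports (`IsCarried`) and counts/sizes (`IsTab`), device functions `θ_l` tied to the cutoff `h` by a hypothesis
`hθ`, and a `Bonds` datum comparing the bond geometry with a frame.  This file builds the CONCRETE carriers of the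
unit periodic lattice and proves that they supply every one of those data, so that instantiating the shape and
order theorems becomes substitution.  CONVENTIONS FIXED HERE: the one-pair setting of `B9SectCLatticeCalc` §§2–3 is
read with `s :=` sites, `b :=` bonds, `xs := id`, `sb := bpos`, `tb := btgt`, `dir := Prod.snd`; the pair setting
of `B9SectCLatticeCurl` §2 with "bonds" `:=` bonds (`xb := bpos`), "plaquettes" `:=` plaquettes (`sp := ppos`),
pair index `K := Fin d`, `tb := ptgt`; and the site level is ALSO a pair family (`sp := bpos`, `tb_μ := shift μ ∘
bpos`, tables `T_μ, J_μ` = the direction-`μ` rows), which is the form its `h`-linear symbol takes in the order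
bookkeeping (§5).
* §1 **THE LATTICE** `TSite d Pd = Π_i Fin (P_i)` (`B4Sect5Torus`): the unit steps `shift k` / `unshift k`
  (`x ± e_k` mod `P_k`), mutually inverse (`shift_unshift`, `unshift_shift`, `shift_eq_iff`), of torus length `≤ 1`
  (`tdist_shift_le` and three variants; needs `1 ≤ P_i`).
* §2 **THE CARRIERS**: `Bond d Pd = sites × Fin d` (the bond `(x, μ) = ⟨x, x + e_μ⟩`), `DirPair d = {μ < ν}`,
  `Plaq d Pd = sites × DirPair d`; positions `bpos`, `ppos` (= `Prod.fst`), targets `btgt (x, μ) = x + e_μ`,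
  `ptgt k (x, q) = x + e_k` for EVERY `k` (pairs `k ∉ {μ, ν}` get zero tables).
* §3 **THE SITE LEVEL (3.3)/(3.8)**: `sT c r` (bond reads its target site, entry `c·r(b)`), `sJ c` (bond reads its
  base, entry `c`); `sD_mulVec` = the printed (3.3) in scalar reading; supports `isCarried_sT` (`(btgt, id)`),
  `isCarried_sJ` (`(bpos, id)`); `(1, |c|ρ)` / `(1, |c|)`-tables (`isTab_sT`, `isTab_sJ`); column counts `≤ d`
  (`sT_cols`, `sJ_cols`) whence the TRANSPOSES are `(d, ·)`-tables (`isTab_sT_transpose`, `isTab_sJ_transpose`) —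
  for the uniform lattice weights the adjoint (3.8) IS the transpose (`sD_transpose_mulVec` = the printed (3.8));
  the direction-row family `sTd`, `sJd` (`sum_sTd`, `sum_sJd`; carried as a pair family `isCarried_sTd/sJd`;
  `(1, ·)`-tables; column count `1`).  §3b **THE TWO-STEP TABLES ON THE PERIODIC LATTICE**: `Jᵀ·J_μ = c²·1`,
  `Tᵀ·T_μ = c²·r(· − e_μ, μ)²·1` (`sJ_transpose_mul_sJd`, `sT_transpose_mul_sTd`): the defect table of
  `B9SectCLatticeCurl.am₀_exchange` / `B9SectCLatticeOrder.defect_term_eq_zero` is the diagonal UNITARITY DEFECT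
  `c²(1 − r²)`, identically ZERO for a unit-modulus bond field (`site_defect_eq_zero`) — on the full periodic lattice
  with matched weights the hypothesis `hdef` of `opZon_Am₀` is therefore vacuous.
* §4 **THE PLAQUETTE LEVEL (3.4)/(3.5)**: signs `psign` (`+1` at `k = μ`, `−1` at `k = ν`, else `0`) and
  complementary directions `pcomp`; the pair tables `pT c r k` (plaquette reads the far bond `(x + e_k, k̄)`, entry
  `±c·r(x, k)`) and `pJ c k` (near bond `(x, k̄)`, entry `±c`); `pD_mulVec` = one signed covariant difference ((3.3)
  applied to the `k̄`-component — the display following (3.4), p.391; bonds oriented by the convention (3.5)),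
  `curl_mulVec` = the printed (3.4); supports `isCarried_pT` (`(ptgt k, bpos)`), `isCarried_pJ` (`(ppos, bpos)`) —
  the `hT`, `hJ` of `hΛ_shape`; `(1, ·)`-tables (`isTab_pT`, `isTab_pJ`); column counts `≤ |DirPair d|` and the
  transposed tables (`pT_cols`, `pJ_cols`, `isTab_pT_transpose`, `isTab_pJ_transpose`; with
  `B9SectCLatticeOrder.IsTab.wadjoint` / `wadjoint_family_carried` every weighted adjoint family inherits them).
* §5 **THE GLOBAL DEVICES**: the forward device `fdev h l x = h(x + e_l) − h(x)` — ONE function per direction on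
  the whole lattice — for which the hypothesis `hθ` of `hΛ_shape` is DEFINITIONAL (`fdev_ppos`; site pair family:
  `fdev_bpos`), the bond device is its diagonal (`thE_eq_fdev`) and SPLITS over the direction family
  (`thE_mul_sJ_eq_sum`, `thE_mul_sT_eq_sum`: `Θ_h·J = Σ_l diag(θ⁺_l ∘ bpos)·J_l`); the backward device `bdev h μ y =
  h(y) − h(y − e_μ)`, which is the `hθ` of `hM_shape` / `dpart_mul_ThE` for `(id, btgt)`-carried adjoint tables
  (`bdev_of_carried`).  Their GLOBAL FIRST-ORDER FACTS — the hypotheses `hθb` / `hθz` of `opZon_LmH`, `opZon_Dm₁`,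
  `opZon_Am₀_defect` — follow on the full periodic lattice from the two cutoff facts in their `CutModel` shapes with
  the torus distance (`fdev_abs_le`, `fdev_zone`, `bdev_abs_le`, `bdev_zone`; radius `ℓ ≥ 1`, any `r ≥ 1`):
  caveat (2) of `…B9SectCLatticeOrder` is discharged here.
* §6 **THE BOND FACTS AGAINST AN ARBITRARY FRAME** (option (b) of the lineage brief): for any carrier positioned in
  the lattice, the direction bonds `⟨β q, β q + e_k⟩` form a `Bonds F ys tdist ℓ β (k ↦ shift k ∘ β) 1 R` datum as
  soon as neighbouring sites are within frame distance `R` (`bonds_of_steps`; the frame `F`, the site map `ys` and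
  `hfrm` are hypotheses); specialised: `bonds_plaq` (the `hb` of `opZon_ThE/LmD/LmH/Lm₀`), `bonds_site_family`,
  `bonds_dir`, and the one-pair `bonds_site` (`K := Unit`, the `hb` of `opZon_Dm₀/Am₁/Am₀`).
* §7 **SANITY** `opZon_ThE_plaq`: `B9SectCLatticeOrder.opZon_ThE` applied verbatim to these carriers gives the
  plaquette bond device `ThE ppos (ptgt k) h ∈ 𝒵(−1, ω₀·e^{δ₀R₀})` from the two cutoff facts — the end-to-end check
  that the data of this file are what the order theorems consume.

HONEST CAVEATS.  (1) SCALAR READING, `n = 1`: the transporter `R(U(b)) ∈ G ⊂ U(N)` of (3.3)–(3.5) is replaced by a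
REAL bond field `r : bonds → ℝ` (`|r| ≤ ρ`; unit modulus `r² = 1` in `site_defect_eq_zero`).  The genuine
matrix-valued tables fold the colour index into the carriers (bonds `× Fin N`, …) with the same supports and the
counts multiplied by `N`; this is not done here and nothing below depends on commutativity beyond it.  (2) IDENTITIES
AND TYPING ONLY: no estimate of §C, no Green's function, no block frame — the frame `F : Frame S`, the site map `ys`
and the neighbour bound `hfrm : ρ(ys x, ys (x + e_k)) ≤ R` are HYPOTHESES (the `d`-dimensional block frame with
`R = 1` and its `Valid` proof are the next leaf); the curvature term `W` of `hΛ_shape`, the rows `H_kl` of `Dv₂` and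
the plaquette-level two-step tables `J′_kJ_l − T′_kT_l` are instance-side.  (3) UNIT SPACING: the weight `c` stands
for `η⁻¹`; no `η`-scaling, no `L^k`-lattices, no restriction to a subset `Λ ⊂ T_η` (boundary deletions are where
`hdef` and the zero rows genuinely matter — on the full torus they are vacuous, §3b).  The torus needs `1 ≤ P_i`
for the length lemmas; for `P_i ≤ 2` forward and backward steps coincide, which the algebra tolerates.  (4) THE
SECOND-DIFFERENCE DATUM (`hmod₂`/`hzone₂` for `θ_l = fdev h l`, caveat (1) of `…Order`) is NOT derived here and
cannot be derived from `CutModel.modulus`/`.zone`; a lattice `CutModel` instance must carry it.  (5) CONSTANTS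
UNOPTIMISED: the plaquette column counts use `|DirPair d| = d(d−1)/2` where `1` would do, sizes use `|c|ρ`.  (6) NO
`TwoSeq`/`CutModel` TERM IS BUILT: with this file the instance is substitution (`ys := p₁ ∘ blk`, `hmod :=
X.modulus`, `hzone := X.zone`, tables and bonds from §§3–6) plus the block frame and the datum of (4) — census N25
lists the remaining glue.  (7) Value = located typing closing census item D1 up to the frame: NOT summit progress;
no inequality of the paper is touched.  Every declaration carries a docstring and a `[cite: …]` or `[folklore]` tag;
no `sorry`; no `instance`; no `HarnessLib` fact; standard axioms only.
-/

namespace Literature.MathematicalPhysics.QuantumFieldTheory.Balaban1983to89.B9SectCLatticeCarrier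

open Finset
open B4TorusKernel.MultiPeriod (circAbs circAbs_add_mul circAbs_le_abs circAbs_nonneg)
open B4Sect5Torus (TSite ccoord tdist tdist_symm tdist_self circAbs_zero)
open B9SectCDiffEstimate
open B9SectCLatticeCalc (IsCarried ThE)
open B9SectCLatticeOrder (IsTab Bonds)

noncomputable section

/-! ## §1 The periodic lattice `Π_i ℤ/P_iℤ`: unit steps and their torus length -/

section Lattice

variable {d : ℕ} {Pd : Fin d → ℕ}

/-- the forward unit step in coordinate `k`: `x ↦ x + e_k` (mod `P_k`). OURS (typing). [folklore] -/
def shift (k : Fin d) (x : TSite d Pd) : TSite d Pd :=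
  Function.update x k ⟨((x k).val + 1) % Pd k, Nat.mod_lt _ (x k).pos⟩

/-- the backward unit step in coordinate `k`: `x ↦ x − e_k` (mod `P_k`). OURS (typing). [folklore] -/
def unshift (k : Fin d) (x : TSite d Pd) : TSite d Pd :=
  Function.update x k ⟨((x k).val + (Pd k - 1)) % Pd k, Nat.mod_lt _ (x k).pos⟩

/-- the stepped coordinate of `x + e_k` is `(x_k + 1) mod P_k`. [folklore] -/
theorem shift_apply_val (k : Fin d) (x : TSite d Pd) : ((shift k x) k).val = ((x k).val + 1) % Pd k := by
  rw [shift, Function.update_self]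

/-- the other coordinates of `x + e_k` are those of `x`. [folklore] -/
theorem shift_apply_ne {k i : Fin d} (h : i ≠ k) (x : TSite d Pd) : (shift k x) i = x i := by
  rw [shift, Function.update_of_ne h]

/-- the stepped coordinate of `x − e_k` is `(x_k + P_k − 1) mod P_k`. [folklore] -/
theorem unshift_apply_val (k : Fin d) (x : TSite d Pd) :
    ((unshift k x) k).val = ((x k).val + (Pd k - 1)) % Pd k := by
  rw [unshift, Function.update_self]

/-- the other coordinates of `x − e_k` are those of `x`. [folklore] -/
theorem unshift_apply_ne {k i : Fin d} (h : i ≠ k) (x : TSite d Pd) : (unshift k x) i = x i := by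
  rw [unshift, Function.update_of_ne h]

/-- `(x − e_k) + e_k = x`. [folklore] -/
theorem shift_unshift (k : Fin d) (x : TSite d Pd) : shift k (unshift k x) = x := by
  funext i
  by_cases h : i = k
  · subst h
    apply Fin.ext
    rw [shift_apply_val, unshift_apply_val, Nat.mod_add_mod]
    have e : (x i).val + (Pd i - 1) + 1 = (x i).val + Pd i := by have := (x i).pos; omega
    rw [e, Nat.add_mod_right, Nat.mod_eq_of_lt (x i).isLt]
  · rw [shift_apply_ne h, unshift_apply_ne h]

/-- `(x + e_k) − e_k = x`. [folklore] -/
theorem unshift_shift (k : Fin d) (x : TSite d Pd) : unshift k (shift k x) = x := by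
  funext i
  by_cases h : i = k
  · subst h
    apply Fin.ext
    rw [unshift_apply_val, shift_apply_val, Nat.mod_add_mod]
    have e : (x i).val + 1 + (Pd i - 1) = (x i).val + Pd i := by have := (x i).pos; omega
    rw [e, Nat.add_mod_right, Nat.mod_eq_of_lt (x i).isLt]
  · rw [unshift_apply_ne h, shift_apply_ne h]

/-- `x + e_k = y ↔ x = y − e_k`. [folklore] -/
theorem shift_eq_iff (k : Fin d) (x y : TSite d Pd) : shift k x = y ↔ x = unshift k y := by
  constructor
  · rintro rfl; rw [unshift_shift]
  · rintro rfl; rw [shift_unshift]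

/-- the coordinate distances of a unit step are `≤ 1` (`0` off the stepped coordinate). [folklore] -/
theorem ccoord_shift_le (hP : ∀ i, 1 ≤ Pd i) (k : Fin d) (x : TSite d Pd) (i : Fin d) :
    ccoord Pd x (shift k x) i ≤ 1 := by
  unfold ccoord
  rw [Int.toNat_le]
  by_cases h : i = k
  · subst h
    rw [shift_apply_val]
    push_cast
    have e : ((x i).val : ℤ) - (((x i).val : ℤ) + 1) % (Pd i : ℤ) =
        -1 + (Pd i : ℤ) * ((((x i).val : ℤ) + 1) / (Pd i : ℤ)) := by
      have := Int.mul_ediv_add_emod (((x i).val : ℤ) + 1) (Pd i : ℤ)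
      linarith
    rw [e, circAbs_add_mul]
    calc circAbs (Pd i) (-1) ≤ |(-1 : ℤ)| := circAbs_le_abs (hP i) _
      _ = 1 := by norm_num
  · rw [shift_apply_ne h, sub_self, circAbs_zero]; norm_num

/-- **a unit step has torus length `≤ 1`.** [folklore] -/
theorem tdist_shift_le (hP : ∀ i, 1 ≤ Pd i) (k : Fin d) (x : TSite d Pd) : tdist Pd x (shift k x) ≤ 1 := by
  unfold tdist
  have h : univ.sup (ccoord Pd x (shift k x)) ≤ 1 := Finset.sup_le fun i _ => ccoord_shift_le hP k x i
  exact_mod_cast h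

/-- a unit step has torus length `≤ 1`, read from the target. [folklore] -/
theorem tdist_shift_le' (hP : ∀ i, 1 ≤ Pd i) (k : Fin d) (x : TSite d Pd) : tdist Pd (shift k x) x ≤ 1 := by
  rw [tdist_symm hP]; exact tdist_shift_le hP k x

/-- a backward unit step has torus length `≤ 1`. [folklore] -/
theorem tdist_unshift_le (hP : ∀ i, 1 ≤ Pd i) (k : Fin d) (x : TSite d Pd) : tdist Pd x (unshift k x) ≤ 1 := by
  have h := tdist_shift_le' hP k (unshift k x)
  rwa [shift_unshift] at h

/-- a backward unit step has torus length `≤ 1`, read from the target. [folklore] -/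
theorem tdist_unshift_le' (hP : ∀ i, 1 ≤ Pd i) (k : Fin d) (x : TSite d Pd) : tdist Pd (unshift k x) x ≤ 1 := by
  have h := tdist_shift_le hP k (unshift k x)
  rwa [shift_unshift] at h

end Lattice

/-! ## §2 The index carriers: bonds, direction pairs, plaquettes; positions and targets -/

section Carriers

variable {d : ℕ} {Pd : Fin d → ℕ}

/-- the (positively oriented) BONDS `⟨x, x + e_μ⟩` of the lattice, as pairs `(x, μ)`. OURS (typing). [folklore] -/
abbrev Bond (d : ℕ) (Pd : Fin d → ℕ) : Type := TSite d Pd × Fin d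

/-- the ordered direction pairs `μ < ν`. OURS (typing). [folklore] -/
abbrev DirPair (d : ℕ) : Type := {q : Fin d × Fin d // q.1 < q.2}

/-- the (positively oriented) PLAQUETTES `p_{μν}(x) = ⟨x, x + e_μ, x + e_μ + e_ν, x + e_ν⟩`, `μ < ν`, as pairs
`(x, (μ, ν))`. OURS (typing). [folklore] -/
abbrev Plaq (d : ℕ) (Pd : Fin d → ℕ) : Type := TSite d Pd × DirPair d

/-- position of a bond = its base site `b₋ = x` (the 1-form carrier's position map `xb`, and the source map `sb`
of the site-level two-part operators). OURS (typing). [folklore] -/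
abbrev bpos : Bond d Pd → TSite d Pd := Prod.fst

/-- target site of a bond: `b₊ = x + e_μ`. OURS (typing). [folklore] -/
abbrev btgt : Bond d Pd → TSite d Pd := fun a => shift a.2 a.1

/-- base site of a plaquette (the map `sp`). OURS (typing). [folklore] -/
abbrev ppos : Plaq d Pd → TSite d Pd := Prod.fst

/-- target site of the pair with index `k` at a plaquette: `x + e_k` — for EVERY direction `k` (the map `tb`; only
`k ∈ {μ, ν}` carry non-zero tables). OURS (typing). [folklore] -/
abbrev ptgt : Fin d → Plaq d Pd → TSite d Pd := fun k p => shift k p.1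

/-- `(x + e_μ) − e_μ = x` read on a bond: `unshift μ b₊ = b₋`. [folklore] -/
theorem unshift_btgt (a : Bond d Pd) : unshift a.2 (btgt a) = bpos a := unshift_shift a.2 a.1

end Carriers

/-! ### Three counting helpers -/

section Helpers

/-- a non-zero `if P then v else 0` forces `P` (and `v ≠ 0`). [folklore] -/
theorem of_ite_ne_zero {P : Prop} [Decidable P] {v : ℝ} (h : (if P then v else 0) ≠ 0) : P ∧ v ≠ 0 := by
  by_cases hP : P
  · exact ⟨hP, by rwa [if_pos hP] at h⟩
  · exact absurd (if_neg hP) h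

/-- a filter all of whose members equal one element has card `≤ 1`. [folklore] -/
theorem card_filter_le_one {α : Type*} [Fintype α] (p : α → Prop) [DecidablePred p] (a₀ : α)
    (h : ∀ a, p a → a = a₀) : (univ.filter p).card ≤ 1 :=
  Finset.card_le_one.2 fun a ha b hb => by
    rw [mem_filter] at ha hb; rw [h a ha.2, h b hb.2]

/-- a filter covered by the image of a map from `ι` has card `≤ |ι|`. [folklore] -/
theorem card_filter_le_card {α ι : Type*} [Fintype α] [Fintype ι] [DecidableEq α] (p : α → Prop)
    [DecidablePred p] (g : ι → α) (h : ∀ a, p a → ∃ i, g i = a) : (univ.filter p).card ≤ Fintype.card ι :=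
  calc (univ.filter p).card ≤ (univ.image g).card := card_le_card fun a ha => by
        rw [mem_filter] at ha
        obtain ⟨i, hi⟩ := h a ha.2
        exact mem_image.2 ⟨i, mem_univ _, hi⟩
    _ ≤ (univ : Finset ι).card := card_image_le
    _ = Fintype.card ι := card_univ

end Helpers

/-! ## §3 The site level: the covariant derivative (3.3) as a two-part operator `T − J : sites → bonds` -/

section SiteLevel

variable {d : ℕ} {Pd : Fin d → ℕ}

/-- **TARGET PART of the covariant derivative on site functions** (scalar reading, `n = 1`): the bond `b = (x, μ)`
reads the site `b₊ = x + e_μ` with the entry `c·r(b)` — `c` the weight (`η⁻¹`), `r(b)` an ARBITRARY real bond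
field standing for the transporter `R(U(b))` (a genuine `N × N` component table would fold the colour index into
the carriers; not done here). OURS (typing). [folklore] -/
def sT (c : ℝ) (r : Bond d Pd → ℝ) : Matrix (Bond d Pd) (TSite d Pd) ℝ :=
  Matrix.of fun a y => if y = btgt a then c * r a else 0

/-- **SOURCE PART**: the bond `b` reads its base site `b₋` with the entry `c`. OURS (typing). [folklore] -/
def sJ (c : ℝ) : Matrix (Bond d Pd) (TSite d Pd) ℝ :=
  Matrix.of fun a y => if y = bpos a then c else 0

/-- the entries of the target part, by definition. [folklore] -/
theorem sT_apply (c : ℝ) (r : Bond d Pd → ℝ) (a : Bond d Pd) (y : TSite d Pd) :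
    sT c r a y = if y = btgt a then c * r a else 0 := rfl

/-- the entries of the source part, by definition. [folklore] -/
theorem sJ_apply (c : ℝ) (a : Bond d Pd) (y : TSite d Pd) : sJ c a y = if y = bpos a then c else 0 := rfl

/-- **THE COVARIANT DERIVATIVE (3.3) ON THE UNIT PERIODIC LATTICE, SCALAR READING**:
`((T − J)f)(b) = c·(r(b)·f(b₊) − f(b₋))` — the printed `(D_μ f)(x) = η⁻¹(R(U(x, x+ηe_μ))f(x+ηe_μ) − f(x))` with
`c = η⁻¹` and the transporter replaced by the scalar bond field `r`. [cite: Balaban1985BackgroundPropagators, (3.3) pp.390–391] -/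
theorem sD_mulVec (c : ℝ) (r : Bond d Pd → ℝ) (f : TSite d Pd → ℝ) (a : Bond d Pd) :
    (sT c r - sJ c).mulVec f a = c * (r a * f (btgt a) - f (bpos a)) := by
  simp only [Matrix.mulVec, dotProduct, Matrix.sub_apply, sT_apply, sJ_apply, sub_mul, Finset.sum_sub_distrib,
    ite_mul, zero_mul, Finset.sum_ite_eq', Finset.mem_univ, if_true]
  ring

/-- the target part is CARRIED by `(btgt, id)`: a row reads only its target site. [cite: Balaban1985BackgroundPropagators, (3.3) pp.390–391] -/
theorem isCarried_sT (c : ℝ) (r : Bond d Pd → ℝ) : IsCarried btgt id (sT c r) :=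
  fun _ _ h => ((of_ite_ne_zero h).1).symm

/-- the source part is carried by `(bpos, id)`. [cite: Balaban1985BackgroundPropagators, (3.3) pp.390–391] -/
theorem isCarried_sJ (c : ℝ) : IsCarried (bpos : Bond d Pd → TSite d Pd) id (sJ c) :=
  fun _ _ h => ((of_ite_ne_zero h).1).symm

/-- ROW COUNT: one target entry per bond. [folklore] -/
theorem sT_rows (c : ℝ) (r : Bond d Pd → ℝ) (a : Bond d Pd) : (univ.filter fun y => sT c r a y ≠ 0).card ≤ 1 :=
  card_filter_le_one _ (btgt a) fun _ h => (of_ite_ne_zero h).1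

/-- ROW COUNT: one source entry per bond. [folklore] -/
theorem sJ_rows (c : ℝ) (a : Bond d Pd) : (univ.filter fun y => sJ c a y ≠ 0).card ≤ 1 :=
  card_filter_le_one _ (bpos a) fun _ h => (of_ite_ne_zero h).1

/-- COLUMN COUNT: a site is the target of at most `d` bonds (`(x − e_μ, μ)`, `μ < d`) — the support datum of the
adjoint (3.8). [cite: Balaban1985BackgroundPropagators, (3.8) p.392] -/
theorem sT_cols (c : ℝ) (r : Bond d Pd → ℝ) (y : TSite d Pd) : (univ.filter fun a => sT c r a y ≠ 0).card ≤ d := by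
  have h := card_filter_le_card (fun a => sT c r a y ≠ 0) (fun μ : Fin d => ((unshift μ y, μ) : Bond d Pd))
    fun a ha => ⟨a.2, by
      have e : y = btgt a := (of_ite_ne_zero ha).1
      rw [e, unshift_btgt]⟩
  rwa [Fintype.card_fin] at h

/-- COLUMN COUNT: a site is the base of at most `d` bonds. [cite: Balaban1985BackgroundPropagators, (3.8) p.392] -/
theorem sJ_cols (c : ℝ) (y : TSite d Pd) : (univ.filter fun a => sJ c a y ≠ 0).card ≤ d := by
  have h := card_filter_le_card (fun a => sJ c a y ≠ 0) (fun μ : Fin d => ((y, μ) : Bond d Pd))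
    fun a ha => ⟨a.2, by
      have e : y = bpos a := (of_ite_ne_zero ha).1
      rw [e]⟩
  rwa [Fintype.card_fin] at h

/-- ENTRY SIZES: `|T(b, ·)| ≤ |c|·ρ` when `|r| ≤ ρ`. [folklore] -/
theorem sT_size {c ρ : ℝ} {r : Bond d Pd → ℝ} (hr : ∀ a, |r a| ≤ ρ) (a : Bond d Pd) (y : TSite d Pd) :
    |sT c r a y| ≤ |c| * ρ := by
  rw [sT_apply]
  by_cases h : y = btgt a
  · rw [if_pos h, abs_mul]; exact mul_le_mul_of_nonneg_left (hr a) (abs_nonneg c)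
  · rw [if_neg h, abs_zero]; exact mul_nonneg (abs_nonneg c) ((abs_nonneg _).trans (hr a))

/-- ENTRY SIZES: `|J(b, ·)| ≤ |c|`. [folklore] -/
theorem sJ_size (c : ℝ) (a : Bond d Pd) (y : TSite d Pd) : |sJ c a y| ≤ |c| := by
  rw [sJ_apply]
  by_cases h : y = bpos a
  · rw [if_pos h]
  · rw [if_neg h, abs_zero]; exact abs_nonneg c

/-- **`T` IS A `(1, |c|ρ)`-TABLE** (the `h`-free datum consumed by the order bookkeeping of
`B9SectCLatticeOrder`). [cite: Balaban1985BackgroundPropagators, (3.3) pp.390–391] -/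
theorem isTab_sT {c ρ : ℝ} {r : Bond d Pd → ℝ} (hr : ∀ a, |r a| ≤ ρ) : IsTab 1 (|c| * ρ) (sT c r) :=
  ⟨sT_rows c r, sT_size hr⟩

/-- **`J` IS A `(1, |c|)`-TABLE.** [cite: Balaban1985BackgroundPropagators, (3.3) pp.390–391] -/
theorem isTab_sJ (c : ℝ) : IsTab 1 |c| (sJ (d := d) (Pd := Pd) c) :=
  ⟨sJ_rows c, sJ_size c⟩

/-- **THE ADJOINT TABLES**: `Tᵀ` is a `(d, |c|ρ)`-table and `Jᵀ` a `(d, |c|)`-table (column counts; with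
`B9SectCLatticeCalc.IsCarried.transpose` and `B9SectCLatticeOrder.IsTab.wadjoint` every weighted adjoint
`diagonal w′·Tᵀ·diagonal w` inherits supports and table bounds). [cite: Balaban1985BackgroundPropagators, (3.8) p.392] -/
theorem isTab_sT_transpose {c ρ : ℝ} {r : Bond d Pd → ℝ} (hr : ∀ a, |r a| ≤ ρ) :
    IsTab d (|c| * ρ) (sT c r).transpose :=
  B9SectCLatticeOrder.IsTab.transpose_of_cols (sT_cols c r) (sT_size hr)

/-- `Jᵀ` is a `(d, |c|)`-table (column count of `J`). [cite: Balaban1985BackgroundPropagators, (3.8) p.392] -/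
theorem isTab_sJ_transpose (c : ℝ) : IsTab d |c| (sJ (d := d) (Pd := Pd) c).transpose :=
  B9SectCLatticeOrder.IsTab.transpose_of_cols (sJ_cols c) (sJ_size c)

/-- **THE ADJOINT (3.8) ON THE UNIT PERIODIC LATTICE, SCALAR READING**: `((T − J)ᵀA)(x) =
Σ_μ (c·r(x − e_μ, μ)·A(x − e_μ, μ) − c·A(x, μ))` — the printed `(D*A)(x) = Σ_μ η⁻¹(R(U(x, x − ηe_μ))A(x − ηe_μ, x)
− A(x, x + ηe_μ))` (for the uniform weights the adjoint is the transpose). [cite: Balaban1985BackgroundPropagators, (3.8) p.392] -/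
theorem sD_transpose_mulVec (c : ℝ) (r : Bond d Pd → ℝ) (A : Bond d Pd → ℝ) (y : TSite d Pd) :
    (sT c r - sJ c).transpose.mulVec A y = ∑ μ, (c * r (unshift μ y, μ) * A (unshift μ y, μ) - c * A (y, μ)) := by
  simp only [Matrix.mulVec, dotProduct]
  rw [Fintype.sum_prod_type, Finset.sum_comm]
  refine Finset.sum_congr rfl fun μ _ => ?_
  simp only [Matrix.transpose_apply, Matrix.sub_apply, sT_apply, sJ_apply, sub_mul, Finset.sum_sub_distrib,
    ite_mul, zero_mul]
  have e1 : ∀ x : TSite d Pd, (y = btgt (x, μ)) = (x = unshift μ y) := fun x =>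
    propext ⟨fun h => by rw [h]; exact (unshift_shift μ x).symm, fun h => by rw [h]; exact (shift_unshift μ y).symm⟩
  have e2 : ∀ x : TSite d Pd, (y = bpos (x, μ)) = (x = y) := fun x => propext ⟨fun h => h.symm, fun h => h.symm⟩
  simp only [e1, e2, Finset.sum_ite_eq', Finset.mem_univ, if_true]

/-! ### The direction-row family: `T = Σ_μ T_μ`, `J = Σ_μ J_μ` (the site level as a PAIR FAMILY) -/

/-- the direction-`μ` ROWS of the target part: the pair "`D_μ`" of the family `D = Σ_μ D_μ` (rows of the other
directions are zero). OURS (typing). [folklore] -/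
def sTd (c : ℝ) (r : Bond d Pd → ℝ) (μ : Fin d) : Matrix (Bond d Pd) (TSite d Pd) ℝ :=
  Matrix.of fun a y => if a.2 = μ then sT c r a y else 0

/-- the direction-`μ` rows of the source part. OURS (typing). [folklore] -/
def sJd (c : ℝ) (μ : Fin d) : Matrix (Bond d Pd) (TSite d Pd) ℝ :=
  Matrix.of fun a y => if a.2 = μ then sJ c a y else 0

/-- the entries of the direction-`μ` target rows, by definition. [folklore] -/
theorem sTd_apply (c : ℝ) (r : Bond d Pd → ℝ) (μ : Fin d) (a : Bond d Pd) (y : TSite d Pd) :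
    sTd c r μ a y = if a.2 = μ then sT c r a y else 0 := rfl

/-- the entries of the direction-`μ` source rows, by definition. [folklore] -/
theorem sJd_apply (c : ℝ) (μ : Fin d) (a : Bond d Pd) (y : TSite d Pd) :
    sJd c μ a y = if a.2 = μ then sJ c a y else 0 := rfl

/-- `Σ_μ T_μ = T`. [cite: Balaban1985BackgroundPropagators, (3.3) pp.390–391] -/
theorem sum_sTd (c : ℝ) (r : Bond d Pd → ℝ) : ∑ μ, sTd c r μ = sT c r := by
  ext a y
  rw [Matrix.sum_apply]
  simp only [sTd_apply, Finset.sum_ite_eq, Finset.mem_univ, if_true]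

/-- `Σ_μ J_μ = J`. [cite: Balaban1985BackgroundPropagators, (3.3) pp.390–391] -/
theorem sum_sJd (c : ℝ) : ∑ μ, sJd (d := d) (Pd := Pd) c μ = sJ c := by
  ext a y
  rw [Matrix.sum_apply]
  simp only [sJd_apply, Finset.sum_ite_eq, Finset.mem_univ, if_true]

/-- the direction-`μ` target rows are carried by `(x ↦ x + e_μ ∘ bpos, id)` — the pair-family support of
`B9SectCLatticeCurl` §2 with "plaquettes" := bonds, "bonds" := sites, `sp := bpos`, `tb_μ := shift μ ∘ bpos`.
[cite: Balaban1985BackgroundPropagators, (3.3) pp.390–391] -/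
theorem isCarried_sTd (c : ℝ) (r : Bond d Pd → ℝ) (μ : Fin d) :
    IsCarried (fun a : Bond d Pd => shift μ (bpos a)) id (sTd c r μ) := by
  intro a y h
  obtain ⟨hμ, h'⟩ := of_ite_ne_zero h
  have e : y = btgt a := (of_ite_ne_zero h').1
  rw [e, id, ← hμ]

/-- the direction-`μ` source rows are carried by `(bpos, id)`. [cite: Balaban1985BackgroundPropagators, (3.3) pp.390–391] -/
theorem isCarried_sJd (c : ℝ) (μ : Fin d) : IsCarried (bpos : Bond d Pd → TSite d Pd) id (sJd c μ) :=
  fun _ _ h => ((of_ite_ne_zero (of_ite_ne_zero h).2).1).symm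

/-- `T_μ` is a `(1, |c|ρ)`-table. [folklore] -/
theorem isTab_sTd {c ρ : ℝ} {r : Bond d Pd → ℝ} (hr : ∀ a, |r a| ≤ ρ) (μ : Fin d) : IsTab 1 (|c| * ρ) (sTd c r μ) :=
  (isTab_sT hr).of_support (fun a y h => (of_ite_ne_zero h).2) fun a y => by
    rw [sTd_apply]
    by_cases hμ : a.2 = μ
    · rw [if_pos hμ]; exact sT_size hr a y
    · rw [if_neg hμ, abs_zero]; exact mul_nonneg (abs_nonneg c) ((abs_nonneg _).trans (hr a))

/-- `J_μ` is a `(1, |c|)`-table. [folklore] -/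
theorem isTab_sJd (c : ℝ) (μ : Fin d) : IsTab 1 |c| (sJd (d := d) (Pd := Pd) c μ) :=
  (isTab_sJ c).of_support (fun a y h => (of_ite_ne_zero h).2) fun a y => by
    rw [sJd_apply]
    by_cases hμ : a.2 = μ
    · rw [if_pos hμ]; exact sJ_size c a y
    · rw [if_neg hμ, abs_zero]; exact abs_nonneg c

/-- COLUMN COUNT of `T_μ`: a site is the target of exactly one direction-`μ` bond. [folklore] -/
theorem sTd_cols (c : ℝ) (r : Bond d Pd → ℝ) (μ : Fin d) (y : TSite d Pd) :
    (univ.filter fun a => sTd c r μ a y ≠ 0).card ≤ 1 :=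
  card_filter_le_one _ (unshift μ y, μ) fun a ha => by
    obtain ⟨hμ, h'⟩ := of_ite_ne_zero ha
    have e : y = btgt a := (of_ite_ne_zero h').1
    rw [e, ← hμ, unshift_btgt]

/-- COLUMN COUNT of `J_μ`: a site is the base of exactly one direction-`μ` bond. [folklore] -/
theorem sJd_cols (c : ℝ) (μ : Fin d) (y : TSite d Pd) : (univ.filter fun a => sJd c μ a y ≠ 0).card ≤ 1 :=
  card_filter_le_one _ (y, μ) fun a ha => by
    obtain ⟨hμ, h'⟩ := of_ite_ne_zero ha
    have e : y = bpos a := (of_ite_ne_zero h').1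
    rw [e, ← hμ]

end SiteLevel

/-! ### The two-step tables of `DᵀD` on the periodic lattice: the unitarity defect (site level) -/

section SiteDefect

variable {d : ℕ} {Pd : Fin d → ℕ}

/-- **`Jᵀ·J_μ = c²·1`**: the site `y` is the base of exactly one direction-`μ` bond. [cite: Balaban1985BackgroundPropagators, (3.8) p.392] -/
theorem sJ_transpose_mul_sJd (c : ℝ) (μ : Fin d) :
    (sJ c : Matrix (Bond d Pd) (TSite d Pd) ℝ).transpose * (sJd c μ : Matrix (Bond d Pd) (TSite d Pd) ℝ) =
      Matrix.diagonal fun _ => c * c := by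
  ext y y'
  rw [Matrix.mul_apply, Matrix.diagonal_apply, Fintype.sum_prod_type]
  simp only [Matrix.transpose_apply, sJd_apply, mul_ite, mul_zero, Finset.sum_ite_eq', Finset.mem_univ, if_true]
  simp only [sJ_apply, ite_mul, zero_mul]
  have e : ∀ x : TSite d Pd, (y = bpos (x, μ)) = (x = y) := fun x => propext ⟨fun h => h.symm, fun h => h.symm⟩
  simp only [e, Finset.sum_ite_eq', Finset.mem_univ, if_true]
  by_cases h : y = y'
  · subst h
    have h' : y = bpos ((y, μ) : Bond d Pd) := rfl
    rw [if_pos h', if_pos rfl]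
  · have h' : ¬ y' = bpos ((y, μ) : Bond d Pd) := fun e' => h e'.symm
    have h'' : ¬ y' = y := fun e' => h e'.symm
    rw [if_neg h', if_neg h'', mul_zero]

/-- **`Tᵀ·T_μ = c²·r(y − e_μ, μ)²·1`**: the site `y` is the target of exactly one direction-`μ` bond, `(y − e_μ, μ)`;
so on the PERIODIC lattice the two-step table `Jᵀ J_μ − Tᵀ T_μ` is the diagonal UNITARITY DEFECT `c²(1 − r²)`,
zero for a unit-modulus bond field (the scalar shadow of `R(U)*R(U) = 1`). [cite: Balaban1985BackgroundPropagators, (3.8) p.392] -/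
theorem sT_transpose_mul_sTd (c : ℝ) (r : Bond d Pd → ℝ) (μ : Fin d) :
    (sT c r).transpose * sTd c r μ = Matrix.diagonal fun y => c * c * r (unshift μ y, μ) ^ 2 := by
  ext y y'
  rw [Matrix.mul_apply, Matrix.diagonal_apply, Fintype.sum_prod_type]
  simp only [Matrix.transpose_apply, sTd_apply, mul_ite, mul_zero, Finset.sum_ite_eq', Finset.mem_univ, if_true]
  simp only [sT_apply, ite_mul, zero_mul]
  have e : ∀ x : TSite d Pd, (y = btgt (x, μ)) = (x = unshift μ y) := fun x =>
    propext ⟨fun h => by rw [h]; exact (unshift_shift μ x).symm, fun h => by rw [h]; exact (shift_unshift μ y).symm⟩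
  simp only [e, Finset.sum_ite_eq', Finset.mem_univ, if_true]
  by_cases h : y = y'
  · subst h
    have h' : y = btgt ((unshift μ y, μ) : Bond d Pd) := (shift_unshift μ y).symm
    rw [if_pos h', if_pos rfl]
    ring
  · have h' : ¬ y' = btgt ((unshift μ y, μ) : Bond d Pd) := fun e' => h (e'.trans (shift_unshift μ y)).symm
    rw [if_neg h', if_neg h, mul_zero]

/-- the defect table vanishes for a unit-modulus bond field: `Jᵀ J_μ − Tᵀ T_μ = 0` when `r² = 1`. OURS (typing).
[cite: Balaban1985BackgroundPropagators, (3.8) p.392] -/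
theorem site_defect_eq_zero {c : ℝ} {r : Bond d Pd → ℝ} (hr : ∀ a, r a ^ 2 = 1) (μ : Fin d) :
    (sJ c : Matrix (Bond d Pd) (TSite d Pd) ℝ).transpose * (sJd c μ : Matrix (Bond d Pd) (TSite d Pd) ℝ) -
      (sT c r).transpose * sTd c r μ = 0 := by
  rw [sJ_transpose_mul_sJd, sT_transpose_mul_sTd, sub_eq_zero]
  congr 1
  funext y
  rw [hr, mul_one]

end SiteDefect

/-! ## §4 The plaquette level: the curl (3.4)/(3.5) as a pair family `Σ_k (T_k − J_k) : bonds → plaquettes` -/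

section PlaqLevel

variable {d : ℕ} {Pd : Fin d → ℕ}

/-- the SIGN with which the pair of index `k` enters the curl at the plaquette `p_{μν}(x)`: `+1` for `k = μ` (the term
`∇_μ A_ν`), `−1` for `k = ν` (the term `−∇_ν A_μ`), `0` otherwise. OURS (typing). [folklore] -/
def psign (k : Fin d) (q : DirPair d) : ℝ := if k = q.1.1 then 1 else if k = q.1.2 then -1 else 0

/-- the COMPLEMENTARY direction of the pair `k` at `p_{μν}`: `ν` for `k = μ`, else `μ` (the direction of the bonds
the pair reads). OURS (typing). [folklore] -/
def pcomp (k : Fin d) (q : DirPair d) : Fin d := if k = q.1.1 then q.1.2 else q.1.1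

/-- `|psign| ≤ 1`. [folklore] -/
theorem abs_psign_le (k : Fin d) (q : DirPair d) : |psign k q| ≤ 1 := by
  unfold psign; split_ifs <;> norm_num

/-- at `k = μ`: sign `+1`, complementary direction `ν`. [folklore] -/
theorem psign_fst (q : DirPair d) : psign q.1.1 q = 1 := if_pos rfl

/-- at `k = μ` the complementary direction is `ν`. [folklore] -/
theorem pcomp_fst (q : DirPair d) : pcomp q.1.1 q = q.1.2 := if_pos rfl

/-- at `k = ν`: sign `−1`, complementary direction `μ`. [folklore] -/
theorem psign_snd (q : DirPair d) : psign q.1.2 q = -1 := by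
  have h : q.1.2 ≠ q.1.1 := (ne_of_lt q.2).symm
  rw [psign, if_neg h, if_pos rfl]

/-- at `k = ν` the complementary direction is `μ`. [folklore] -/
theorem pcomp_snd (q : DirPair d) : pcomp q.1.2 q = q.1.1 := by
  have h : q.1.2 ≠ q.1.1 := (ne_of_lt q.2).symm
  rw [pcomp, if_neg h]

/-- off the two directions of the plaquette the sign vanishes. [folklore] -/
theorem psign_of_ne {k : Fin d} {q : DirPair d} (h₁ : k ≠ q.1.1) (h₂ : k ≠ q.1.2) : psign k q = 0 := by
  rw [psign, if_neg h₁, if_neg h₂]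

/-- **TARGET PART of the pair `k` of the curl**: the plaquette `p_{μν}(x)` reads the bond `(x + e_k, k̄)` (`k̄` the
complementary direction) with the entry `±c·r(x, k)` — the transported far bond of `∇_μ A_ν` (`k = μ`) resp. of
`−∇_ν A_μ` (`k = ν`); zero tables for `k ∉ {μ, ν}`. Scalar reading as in `sT`. OURS (typing). [folklore] -/
def pT (c : ℝ) (r : Bond d Pd → ℝ) (k : Fin d) : Matrix (Plaq d Pd) (Bond d Pd) ℝ :=
  Matrix.of fun p a => if a = (shift k p.1, pcomp k p.2) then psign k p.2 * (c * r (p.1, k)) else 0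

/-- **SOURCE PART of the pair `k`**: `p_{μν}(x)` reads the near bond `(x, k̄)` with the entry `±c`. OURS (typing). [folklore] -/
def pJ (c : ℝ) (k : Fin d) : Matrix (Plaq d Pd) (Bond d Pd) ℝ :=
  Matrix.of fun p a => if a = (p.1, pcomp k p.2) then psign k p.2 * c else 0

/-- the entries of the pair target table, by definition. [folklore] -/
theorem pT_apply (c : ℝ) (r : Bond d Pd → ℝ) (k : Fin d) (p : Plaq d Pd) (a : Bond d Pd) :
    pT c r k p a = if a = (shift k p.1, pcomp k p.2) then psign k p.2 * (c * r (p.1, k)) else 0 := rfl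

/-- the entries of the pair source table, by definition. [folklore] -/
theorem pJ_apply (c : ℝ) (k : Fin d) (p : Plaq d Pd) (a : Bond d Pd) :
    pJ c k p a = if a = (p.1, pcomp k p.2) then psign k p.2 * c else 0 := rfl

/-- **ONE PAIR OF THE CURL**: `((T_k − J_k)A)(p) = ε_k(p)·c·(r(x, k)·A(x + e_k, k̄) − A(x, k̄))` — the covariant
difference `D_k` ((3.3) applied to the component `A_{k̄}`: the display following (3.4), p.391; the reversed bonds of
the plaquette contour read through the orientation convention (3.5)), with its sign.
[cite: Balaban1985BackgroundPropagators, (3.3)/(3.4) p.391] -/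
theorem pD_mulVec (c : ℝ) (r : Bond d Pd → ℝ) (k : Fin d) (A : Bond d Pd → ℝ) (p : Plaq d Pd) :
    (pT c r k - pJ c k).mulVec A p =
      psign k p.2 * (c * (r (p.1, k) * A (shift k p.1, pcomp k p.2) - A (p.1, pcomp k p.2))) := by
  simp only [Matrix.mulVec, dotProduct, Matrix.sub_apply, pT_apply, pJ_apply, sub_mul, Finset.sum_sub_distrib,
    ite_mul, zero_mul, Finset.sum_ite_eq', Finset.mem_univ, if_true]
  ring

/-- **THE CURL (3.4) ON THE UNIT PERIODIC LATTICE, SCALAR READING**: summed over the pair index,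
`(Σ_k (T_k − J_k)A)(p_{μν}(x)) = c·(r(x, μ)A(x + e_μ, ν) − A(x, ν)) − c·(r(x, ν)A(x + e_ν, μ) − A(x, μ))` — the printed
`(DA)(p_{μν}(x)) = (D_μ A_ν)(x) − (D_ν A_μ)(x)` with `(D_μ A_ν)(x) = η⁻¹(R(U(x, x + ηe_μ))A(x + ηe_μ, ν) − A(x, ν))`
((3.3) with the identification `A(x, x + ηe_μ) = A_μ(x)` — the display following (3.4), p.391; orientation (3.5)),
`c = η⁻¹`, transporter ↦ scalar bond field. [cite: Balaban1985BackgroundPropagators, (3.4) p.391] -/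
theorem curl_mulVec (c : ℝ) (r : Bond d Pd → ℝ) (A : Bond d Pd → ℝ) (x : TSite d Pd) (q : DirPair d) :
    (∑ k, (pT c r k - pJ c k)).mulVec A (x, q) =
      c * (r (x, q.1.1) * A (shift q.1.1 x, q.1.2) - A (x, q.1.2)) -
        c * (r (x, q.1.2) * A (shift q.1.2 x, q.1.1) - A (x, q.1.1)) := by
  have hne : q.1.1 ≠ q.1.2 := ne_of_lt q.2
  have hsum : (∑ k, (pT c r k - pJ c k)).mulVec A (x, q) = ∑ k, (pT c r k - pJ c k).mulVec A (x, q) := by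
    simp only [Matrix.mulVec, dotProduct, Matrix.sum_apply, Finset.sum_mul]
    rw [Finset.sum_comm]
  rw [hsum, Fintype.sum_eq_add q.1.1 q.1.2 hne fun k hk => by rw [pD_mulVec, psign_of_ne hk.1 hk.2, zero_mul]]
  rw [pD_mulVec, pD_mulVec, psign_fst, pcomp_fst, psign_snd, pcomp_snd]
  ring

/-- **THE PAIR TABLES ARE CARRIED**: `T_k` by `(ptgt k, bpos)` — a row reads only bonds positioned at `x + e_k`.
[cite: Balaban1985BackgroundPropagators, (3.4) p.391] -/
theorem isCarried_pT (c : ℝ) (r : Bond d Pd → ℝ) : ∀ k, IsCarried (ptgt k) (bpos : Bond d Pd → TSite d Pd) (pT c r k) :=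
  fun _ _ _ h => by rw [(of_ite_ne_zero h).1]

/-- `J_k` is carried by `(ppos, bpos)`. [cite: Balaban1985BackgroundPropagators, (3.4) p.391] -/
theorem isCarried_pJ (c : ℝ) : ∀ k, IsCarried (ppos : Plaq d Pd → TSite d Pd) (bpos : Bond d Pd → TSite d Pd) (pJ c k) :=
  fun _ _ _ h => by rw [(of_ite_ne_zero h).1]

/-- ROW COUNT: one target bond per (plaquette, pair). [folklore] -/
theorem pT_rows (c : ℝ) (r : Bond d Pd → ℝ) (k : Fin d) (p : Plaq d Pd) :
    (univ.filter fun a => pT c r k p a ≠ 0).card ≤ 1 :=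
  card_filter_le_one _ _ fun _ h => (of_ite_ne_zero h).1

/-- ROW COUNT: one source bond per (plaquette, pair). [folklore] -/
theorem pJ_rows (c : ℝ) (k : Fin d) (p : Plaq d Pd) : (univ.filter fun a => pJ c k p a ≠ 0).card ≤ 1 :=
  card_filter_le_one _ _ fun _ h => (of_ite_ne_zero h).1

/-- ENTRY SIZES: `|T_k(p, ·)| ≤ |c|·ρ` when `|r| ≤ ρ`. [folklore] -/
theorem pT_size {c ρ : ℝ} {r : Bond d Pd → ℝ} (hr : ∀ a, |r a| ≤ ρ) (k : Fin d) (p : Plaq d Pd) (a : Bond d Pd) :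
    |pT c r k p a| ≤ |c| * ρ := by
  have h0 : 0 ≤ |c| * ρ := mul_nonneg (abs_nonneg c) ((abs_nonneg _).trans (hr (p.1, k)))
  rw [pT_apply]
  split_ifs
  · rw [abs_mul, abs_mul]
    calc |psign k p.2| * (|c| * |r (p.1, k)|) ≤ 1 * (|c| * ρ) :=
          mul_le_mul (abs_psign_le k p.2) (mul_le_mul_of_nonneg_left (hr _) (abs_nonneg c))
            (mul_nonneg (abs_nonneg _) (abs_nonneg _)) zero_le_one
      _ = |c| * ρ := one_mul _
  · rw [abs_zero]; exact h0

/-- ENTRY SIZES: `|J_k(p, ·)| ≤ |c|`. [folklore] -/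
theorem pJ_size (c : ℝ) (k : Fin d) (p : Plaq d Pd) (a : Bond d Pd) : |pJ c k p a| ≤ |c| := by
  rw [pJ_apply]
  split_ifs
  · rw [abs_mul]
    calc |psign k p.2| * |c| ≤ 1 * |c| := mul_le_mul_of_nonneg_right (abs_psign_le k p.2) (abs_nonneg c)
      _ = |c| := one_mul _
  · rw [abs_zero]; exact abs_nonneg c

/-- **`T_k` IS A `(1, |c|ρ)`-TABLE, for every pair index.** [cite: Balaban1985BackgroundPropagators, (3.4) p.391] -/
theorem isTab_pT {c ρ : ℝ} {r : Bond d Pd → ℝ} (hr : ∀ a, |r a| ≤ ρ) : ∀ k, IsTab 1 (|c| * ρ) (pT c r k) :=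
  fun k => ⟨pT_rows c r k, pT_size hr k⟩

/-- **`J_k` IS A `(1, |c|)`-TABLE.** [cite: Balaban1985BackgroundPropagators, (3.4) p.391] -/
theorem isTab_pJ (c : ℝ) : ∀ k, IsTab 1 |c| (pJ (d := d) (Pd := Pd) c k) :=
  fun k => ⟨pJ_rows c k, pJ_size c k⟩

/-- COLUMN COUNT: a bond is the target bond of the pair `k` of at most `|DirPair d| = d(d−1)/2` plaquettes (all
based at `a₋ − e_k`) — the support datum of the adjoint `D*` on 2-forms. [cite: Balaban1985BackgroundPropagators, (3.9) p.392] -/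
theorem pT_cols (c : ℝ) (r : Bond d Pd → ℝ) (k : Fin d) (a : Bond d Pd) :
    (univ.filter fun p => pT c r k p a ≠ 0).card ≤ Fintype.card (DirPair d) :=
  card_filter_le_card _ (fun q : DirPair d => ((unshift k a.1, q) : Plaq d Pd)) fun p hp => ⟨p.2, by
    have e : a = (shift k p.1, pcomp k p.2) := (of_ite_ne_zero hp).1
    rw [e, unshift_shift]⟩

/-- COLUMN COUNT: a bond is the source bond of the pair `k` of at most `|DirPair d|` plaquettes (all based at `a₋`).
[cite: Balaban1985BackgroundPropagators, (3.9) p.392] -/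
theorem pJ_cols (c : ℝ) (k : Fin d) (a : Bond d Pd) :
    (univ.filter fun p => pJ c k p a ≠ 0).card ≤ Fintype.card (DirPair d) :=
  card_filter_le_card _ (fun q : DirPair d => ((a.1, q) : Plaq d Pd)) fun p hp => ⟨p.2, by
    have e : a = (p.1, pcomp k p.2) := (of_ite_ne_zero hp).1
    rw [e]⟩

/-- **THE ADJOINT PAIR TABLES**: `T_kᵀ` is a `(|DirPair d|, |c|ρ)`-table, `J_kᵀ` a `(|DirPair d|, |c|)`-table.
[cite: Balaban1985BackgroundPropagators, (3.9) p.392] -/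
theorem isTab_pT_transpose {c ρ : ℝ} {r : Bond d Pd → ℝ} (hr : ∀ a, |r a| ≤ ρ) (k : Fin d) :
    IsTab (Fintype.card (DirPair d)) (|c| * ρ) (pT c r k).transpose :=
  B9SectCLatticeOrder.IsTab.transpose_of_cols (pT_cols c r k) (pT_size hr k)

/-- `J_kᵀ` is a `(|DirPair d|, |c|)`-table (column count of `J_k`). [cite: Balaban1985BackgroundPropagators, (3.9) p.392] -/
theorem isTab_pJ_transpose (c : ℝ) (k : Fin d) :
    IsTab (Fintype.card (DirPair d)) |c| (pJ (d := d) (Pd := Pd) c k).transpose :=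
  B9SectCLatticeOrder.IsTab.transpose_of_cols (pJ_cols c k) (pJ_size c k)

end PlaqLevel

/-! ## §5 The GLOBAL direction devices and their cutoff facts -/

section Devices

variable {d : ℕ} {Pd : Fin d → ℕ}

/-- **THE FORWARD DEVICE** `θ⁺_l(x) = h(x + e_l) − h(x)` of a site function `h` — ONE GLOBAL function per
direction (no cell-local device), the `θs l` of `B9SectCLatticeCurl.hΛ_shape`. OURS (typing). [folklore] -/
def fdev (h : TSite d Pd → ℝ) (l : Fin d) (x : TSite d Pd) : ℝ := h (shift l x) - h x

/-- **THE BACKWARD DEVICE** `θ⁻_μ(y) = h(y) − h(y − e_μ)`, the `θs μ` of `B9SectCLatticeCalc.hM_shape` (whose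
carrier map `xs` is the identity of the TARGET site). OURS (typing). [folklore] -/
def bdev (h : TSite d Pd → ℝ) (μ : Fin d) (y : TSite d Pd) : ℝ := h y - h (unshift μ y)

/-- **`hθ` OF `hΛ_shape` IS DEFINITIONAL at the plaquette level**: `θ⁺_l(sp p) = h(tb_l p) − h(sp p)`. OURS (typing).
[cite: Balaban1985BackgroundPropagators, (3.4) p.391] -/
theorem fdev_ppos (h : TSite d Pd → ℝ) : ∀ (l : Fin d) (p : Plaq d Pd), fdev h l (ppos p) = h (ptgt l p) - h (ppos p) :=
  fun _ _ => rfl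

/-- … and at the site level read as a pair family (`sp := bpos`, `tb_l := shift l ∘ bpos`). OURS (typing).
[cite: Balaban1985BackgroundPropagators, (3.3) pp.390–391] -/
theorem fdev_bpos (h : TSite d Pd → ℝ) :
    ∀ (l : Fin d) (a : Bond d Pd), fdev h l (bpos a) = h (shift l (bpos a)) - h (bpos a) :=
  fun _ _ => rfl

/-- the diagonal of forward differences along bonds IS the bond device `Θ_h = ThE bpos btgt h` read through `fdev`:
`Θ_h(a, a) = θ⁺_{dir a}(a₋)`. OURS (typing). [cite: Balaban1985BackgroundPropagators, (3.3) pp.390–391] -/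
theorem thE_eq_fdev (h : TSite d Pd → ℝ) :
    ThE (bpos : Bond d Pd → TSite d Pd) btgt h = Matrix.diagonal fun a => fdev h a.2 (bpos a) := rfl

/-- **THE BOND DEVICE SPLITS OVER THE DIRECTION FAMILY (source part)**: `Θ_h·J = Σ_l diag(θ⁺_l ∘ bpos)·J_l` —
the form in which the site-level `h`-linear symbol `J′Θ_hJ − T′Θ_hT` of `B9SectCLatticeCalc.hA_shape` meets the
pair-family order bookkeeping of `B9SectCLatticeOrder` (one GLOBAL device per direction). OURS (typing).
[cite: Balaban1985BackgroundPropagators, (3.3) pp.390–391] -/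
theorem thE_mul_sJ_eq_sum (h : TSite d Pd → ℝ) (c : ℝ) :
    ThE (bpos : Bond d Pd → TSite d Pd) btgt h * (sJ c : Matrix (Bond d Pd) (TSite d Pd) ℝ) =
      ∑ l, Matrix.diagonal (fun a : Bond d Pd => fdev h l (bpos a)) * (sJd c l : Matrix (Bond d Pd) (TSite d Pd) ℝ) := by
  ext a y
  rw [thE_eq_fdev, Matrix.sum_apply, Matrix.diagonal_mul]
  simp only [Matrix.diagonal_mul, sJd_apply, mul_ite, mul_zero, Finset.sum_ite_eq, Finset.mem_univ, if_true]

/-- **… (target part)**: `Θ_h·T = Σ_l diag(θ⁺_l ∘ bpos)·T_l`. OURS (typing). [cite: Balaban1985BackgroundPropagators, (3.3) pp.390–391] -/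
theorem thE_mul_sT_eq_sum (h : TSite d Pd → ℝ) (c : ℝ) (r : Bond d Pd → ℝ) :
    ThE (bpos : Bond d Pd → TSite d Pd) btgt h * sT c r =
      ∑ l, Matrix.diagonal (fun a : Bond d Pd => fdev h l (bpos a)) * sTd c r l := by
  ext a y
  rw [thE_eq_fdev, Matrix.sum_apply, Matrix.diagonal_mul]
  simp only [Matrix.diagonal_mul, sTd_apply, mul_ite, mul_zero, Finset.sum_ite_eq, Finset.mem_univ, if_true]

/-- **`hθ` OF `hM_shape` VIA THE BACKWARD DEVICE**: for a table `T′ : sites × bonds` carried by `(id, btgt)` (an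
adjoint target part), `θ⁻_{dir c}(v) = h(c₊) − h(c₋)` on its support. OURS (typing). [cite: Balaban1985BackgroundPropagators, (3.8) p.392] -/
theorem bdev_of_carried {T' : Matrix (TSite d Pd) (Bond d Pd) ℝ} (hT' : IsCarried id btgt T') (h : TSite d Pd → ℝ) :
    ∀ v c, T' v c ≠ 0 → bdev h c.2 (id v) = h (btgt c) - h (bpos c) := by
  intro v c hvc
  rw [hT' v c hvc, bdev, unshift_btgt]

variable {S : Type*} {F : Frame S} {ys : TSite d Pd → S} {ℓ : TSite d Pd → ℝ} {h : TSite d Pd → ℝ} {ω₀ r : ℝ}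

/-- **THE FORWARD DEVICE UNDER THE CUTOFF MODULUS**: if `|h(e) − h(e′)| ≤ ω₀·sc(ys e)⁻¹·dist(e, e′)` within the
localisation radius `ℓ ≥ 1` (the `CutModel.modulus` shape, torus distance), then `|θ⁺_l(x)| ≤ ω₀·r·sc(ys x)⁻¹` for
any `r ≥ 1` — the `hθb` hypothesis of `B9SectCLatticeOrder.opZon_LmH` / `opZon_Dm₁` / `opZon_Am₀_defect`.
OURS (typing). [cite: Balaban1985BackgroundPropagators, (3.3) pp.390–391] -/
theorem fdev_abs_le (hF : F.Valid) (hP : ∀ i, 1 ≤ Pd i) (hω₀ : 0 ≤ ω₀) (h1r : 1 ≤ r) (hℓ : ∀ x, 1 ≤ ℓ x)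
    (hmod : ∀ e e', tdist Pd e e' ≤ ℓ e → |h e - h e'| ≤ ω₀ * (F.sc (ys e))⁻¹ * tdist Pd e e') :
    ∀ l x, |fdev h l x| ≤ ω₀ * r * (F.sc (ys x))⁻¹ := by
  intro l x
  have hd := tdist_shift_le hP l x
  have hw : 0 ≤ ω₀ * (F.sc (ys x))⁻¹ := mul_nonneg hω₀ (inv_nonneg.2 (hF.hsc _).le)
  rw [fdev, abs_sub_comm]
  calc |h x - h (shift l x)| ≤ ω₀ * (F.sc (ys x))⁻¹ * tdist Pd x (shift l x) := hmod _ _ (hd.trans (hℓ x))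
    _ ≤ ω₀ * (F.sc (ys x))⁻¹ * r := mul_le_mul_of_nonneg_left (hd.trans h1r) hw
    _ = ω₀ * r * (F.sc (ys x))⁻¹ := by ring

/-- **THE FORWARD DEVICE UNDER THE ZONE FACT**: if `h` is constant within radius `ℓ` off the deletion zone
(`CutModel.zone` shape), then `θ⁺_l(x) ≠ 0 → β(ys x) = 0` — the `hθz` hypothesis. OURS (typing).
[cite: Balaban1985BackgroundPropagators, (3.3) pp.390–391] -/
theorem fdev_zone (hP : ∀ i, 1 ≤ Pd i) (hℓ : ∀ x, 1 ≤ ℓ x)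
    (hzone : ∀ e e', tdist Pd e e' ≤ ℓ e → h e ≠ h e' → F.β (ys e) = 0) :
    ∀ l x, fdev h l x ≠ 0 → F.β (ys x) = 0 :=
  fun l x hne => hzone _ _ ((tdist_shift_le hP l x).trans (hℓ x)) fun he => hne (by rw [fdev, ← he, sub_self])

/-- the backward device under the cutoff modulus: `|θ⁻_μ(y)| ≤ ω₀·r·sc(ys y)⁻¹`. OURS (typing).
[cite: Balaban1985BackgroundPropagators, (3.8) p.392] -/
theorem bdev_abs_le (hF : F.Valid) (hP : ∀ i, 1 ≤ Pd i) (hω₀ : 0 ≤ ω₀) (h1r : 1 ≤ r) (hℓ : ∀ x, 1 ≤ ℓ x)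
    (hmod : ∀ e e', tdist Pd e e' ≤ ℓ e → |h e - h e'| ≤ ω₀ * (F.sc (ys e))⁻¹ * tdist Pd e e') :
    ∀ μ y, |bdev h μ y| ≤ ω₀ * r * (F.sc (ys y))⁻¹ := by
  intro μ y
  have hd := tdist_unshift_le hP μ y
  have hw : 0 ≤ ω₀ * (F.sc (ys y))⁻¹ := mul_nonneg hω₀ (inv_nonneg.2 (hF.hsc _).le)
  rw [bdev]
  calc |h y - h (unshift μ y)| ≤ ω₀ * (F.sc (ys y))⁻¹ * tdist Pd y (unshift μ y) := hmod _ _ (hd.trans (hℓ y))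
    _ ≤ ω₀ * (F.sc (ys y))⁻¹ * r := mul_le_mul_of_nonneg_left (hd.trans h1r) hw
    _ = ω₀ * r * (F.sc (ys y))⁻¹ := by ring

/-- the backward device under the zone fact: `θ⁻_μ(y) ≠ 0 → β(ys y) = 0`. OURS (typing).
[cite: Balaban1985BackgroundPropagators, (3.8) p.392] -/
theorem bdev_zone (hP : ∀ i, 1 ≤ Pd i) (hℓ : ∀ x, 1 ≤ ℓ x)
    (hzone : ∀ e e', tdist Pd e e' ≤ ℓ e → h e ≠ h e' → F.β (ys e) = 0) :
    ∀ μ y, bdev h μ y ≠ 0 → F.β (ys y) = 0 :=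
  fun μ y hne => hzone _ _ ((tdist_unshift_le hP μ y).trans (hℓ y)) fun he => hne (by rw [bdev, he, sub_self])

end Devices

/-! ## §6 The bond facts of the carriers against an ARBITRARY frame (option (b): the block frame is instance-side) -/

section BondFacts

variable {d : ℕ} {Pd : Fin d → ℕ} {S : Type*} {F : Frame S} {ys : TSite d Pd → S} {ℓ : TSite d Pd → ℝ} {R : ℝ}

/-- **MASTER BOND FACT**: for ANY carrier `Q` positioned by `β : Q → sites`, the direction-indexed bonds
`⟨β q, β q + e_k⟩` have torus length `≤ 1 ≤ ℓ`, so they satisfy `Bonds F ys dist ℓ β (k ↦ shift k ∘ β) 1 R` as soon as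
the frame distance of neighbouring sites is `≤ R` (`hfrm`, the one genuinely frame-dependent datum, left to the
instance: for the block frame `R = 1`). OURS (typing). [folklore] -/
theorem bonds_of_steps {Q : Type*} (β : Q → TSite d Pd) (hP : ∀ i, 1 ≤ Pd i) (hℓ : ∀ x, 1 ≤ ℓ x) (hR : 0 ≤ R)
    (hfrm : ∀ x k, F.ρ (ys x) (ys (shift k x)) ≤ R) :
    Bonds F ys (tdist Pd) ℓ β (fun k q => shift k (β q)) 1 R :=
  { r_nonneg := zero_le_one
    R_nonneg := hR
    len_s := fun k q => tdist_shift_le hP k (β q)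
    len_t := fun k q => tdist_shift_le' hP k (β q)
    loc_s := fun k q => (tdist_shift_le hP k (β q)).trans (hℓ _)
    loc_t := fun k q => (tdist_shift_le' hP k (β q)).trans (hℓ _)
    frm := fun k q => hfrm (β q) k }

/-- **PLAQUETTE-LEVEL BONDS** `(ppos, ptgt)`: the `hb` of `B9SectCLatticeOrder.opZon_ThE` / `opZon_LmD` / `opZon_LmH` /
`opZon_Lm₀` for the curl family of §4. OURS (typing). [cite: Balaban1985BackgroundPropagators, (3.4) p.391] -/
theorem bonds_plaq (hP : ∀ i, 1 ≤ Pd i) (hℓ : ∀ x, 1 ≤ ℓ x) (hR : 0 ≤ R)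
    (hfrm : ∀ x k, F.ρ (ys x) (ys (shift k x)) ≤ R) :
    Bonds F ys (tdist Pd) ℓ (ppos : Plaq d Pd → TSite d Pd) ptgt 1 R :=
  bonds_of_steps ppos hP hℓ hR hfrm

/-- **SITE-LEVEL BONDS, PAIR-FAMILY READING** `(bpos, k ↦ shift k ∘ bpos)`: the `hb` for the direction-row family
`T_μ, J_μ` of §3. OURS (typing). [cite: Balaban1985BackgroundPropagators, (3.3) pp.390–391] -/
theorem bonds_site_family (hP : ∀ i, 1 ≤ Pd i) (hℓ : ∀ x, 1 ≤ ℓ x) (hR : 0 ≤ R)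
    (hfrm : ∀ x k, F.ρ (ys x) (ys (shift k x)) ≤ R) :
    Bonds F ys (tdist Pd) ℓ (bpos : Bond d Pd → TSite d Pd) (fun k a => shift k (bpos a)) 1 R :=
  bonds_of_steps bpos hP hℓ hR hfrm

/-- **DIRECTION BONDS AT SITES** `(id, shift)`: the `hb` for devices read at sites (the `xs := id` carrier of
`hM_shape`). OURS (typing). [folklore] -/
theorem bonds_dir (hP : ∀ i, 1 ≤ Pd i) (hℓ : ∀ x, 1 ≤ ℓ x) (hR : 0 ≤ R)
    (hfrm : ∀ x k, F.ρ (ys x) (ys (shift k x)) ≤ R) :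
    Bonds F ys (tdist Pd) ℓ (id : TSite d Pd → TSite d Pd) (fun k x => shift k x) 1 R :=
  bonds_of_steps id hP hℓ hR hfrm

/-- **SITE-LEVEL BONDS, ONE-PAIR READING** `(bpos, btgt)` with `K := Unit`: the `hb` of
`B9SectCLatticeOrder.opZon_Dm₀` / `opZon_Am₁` / `opZon_Am₀` for the two-part operator `T − J` of §3. OURS (typing).
[cite: Balaban1985BackgroundPropagators, (3.3) pp.390–391] -/
theorem bonds_site (hP : ∀ i, 1 ≤ Pd i) (hℓ : ∀ x, 1 ≤ ℓ x) (hR : 0 ≤ R)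
    (hfrm : ∀ x k, F.ρ (ys x) (ys (shift k x)) ≤ R) :
    Bonds F ys (tdist Pd) ℓ (bpos : Bond d Pd → TSite d Pd) (fun _ : Unit => btgt) 1 R :=
  { r_nonneg := zero_le_one
    R_nonneg := hR
    len_s := fun _ a => tdist_shift_le hP a.2 a.1
    len_t := fun _ a => tdist_shift_le' hP a.2 a.1
    loc_s := fun _ a => (tdist_shift_le hP a.2 a.1).trans (hℓ _)
    loc_t := fun _ a => (tdist_shift_le' hP a.2 a.1).trans (hℓ _)
    frm := fun _ a => hfrm a.1 a.2 }

end BondFacts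

/-! ## §7 Sanity: the order bookkeeping of `B9SectCLatticeOrder` applies to the lattice carriers verbatim -/

section Sanity

variable {d : ℕ} {Pd : Fin d → ℕ} {S U V : Type*} [DecidableEq V] {F : Frame S} {ys : TSite d Pd → S}
  {ℓ : TSite d Pd → ℝ} {h : TSite d Pd → ℝ} {ω₀ R R₀ : ℝ} {pU : U → S} {pV : V → S}
  {bP : Plaq d Pd → U} {bP' : Plaq d Pd → V}

/-- **THE PLAQUETTE BOND DEVICE OF THE LATTICE IS IN `𝒵(−1, ω₀·e^{δ₀R₀})`**: `B9SectCLatticeOrder.opZon_ThE`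
instantiated with the carriers of §2, the torus distance, the bond facts of §6 (`r = 1`) and the two cutoff facts in
their `CutModel` shapes — the end-to-end check that the carrier data of this module are exactly what the order
theorems consume (nothing new is proved). OURS (typing). [cite: Balaban1985BackgroundPropagators, (3.4) p.391] -/
theorem opZon_ThE_plaq (hF : F.Valid) (hP : ∀ i, 1 ≤ Pd i) (hω₀ : 0 ≤ ω₀) (hℓ : ∀ x, 1 ≤ ℓ x) (hR : 0 ≤ R)
    (hfrm : ∀ x k, F.ρ (ys x) (ys (shift k x)) ≤ R)
    (hmod : ∀ e e', tdist Pd e e' ≤ ℓ e → |h e - h e'| ≤ ω₀ * (F.sc (ys e))⁻¹ * tdist Pd e e')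
    (hzone : ∀ e e', tdist Pd e e' ≤ ℓ e → h e ≠ h e' → F.β (ys e) = 0)
    (hbP : ∀ p, pU (bP p) = ys (ppos p)) (hbP' : ∀ p, F.ρ (ys (ppos p)) (pV (bP' p)) ≤ R₀) (k : Fin d) :
    OpZon F bP bP' pU pV (-1) (ω₀ * 1 * Real.exp (F.δ₀ * R₀)) (ThE (ppos : Plaq d Pd → TSite d Pd) (ptgt k) h) :=
  B9SectCLatticeOrder.opZon_ThE hF hω₀ hmod hzone (bonds_plaq hP hℓ hR hfrm) hbP hbP' k

end Sanity

end

end Literature.MathematicalPhysics.QuantumFieldTheory.Balaban1983to89.B9SectCLatticeCarrier
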